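import Summits.RiemannHypothesis.RiemannHypothesis.Theses.WeilParity

/-!
# Crux attack on `WeilParity.OffLineParityDetection` (stmt-RiemannHypothesis-15431)

Refuter findings (crux-attack, 2026-08-17), all kernel-checked below:

* `offLineParityDetection_iff_target_imp` : the crux `C` is LOGICALLY EQUIVALENT to
  `EvenSectorWins → RH-in-the-strip` — i.e. it is exactly the route's converse (target → summit),
  with no independent content: its conclusion does not mention the zero `ρ`
  (`offLineParityDetection_iff_or`: `C ↔ RHstrip ∨ OddSectorStrictlyWins`), and
  `OddSectorStrictlyWins ↔ ¬ EvenSectorWins` (`oddSectorStrictlyWins_iff_not_evenSectorWins`).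
* `offLineParityDetection_of_rhStrip`, `offLineParityDetection_of_riemannHypothesis` : `S → C`
  (vacuous under RH; the binder shape discharges Mathlib's trivial-zero and `s ≠ 1` side conditions).
* `not_offLineParityDetection_iff` : `¬ C ↔ (EvenSectorWins ∧ ∃ off-line zero)`; hence
  `not_riemannHypothesis_of_not` : any refutation of the crux disproves RH (and proves the route
  target), so the crux is unrefutable short of ¬RH, and unprovable short of the full converse
  `EvenSectorWins → RH`.
-/

set_option linter.dupNamespace false

namespace Summit.RiemannHypothesis.RiemannHypothesis.Cruxes.OffLineParityDetection.CruxAttack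

open Summit.RiemannHypothesis.RiemannHypothesis.Theses.WeilParity
open Literature.NumberTheory.LFunctions MeasureTheory

/-- RH in the open critical strip — the negation of the crux's antecedent class. -/
def RHStrip : Prop :=
  ∀ ρ : ℂ, riemannZeta ρ = 0 → 0 < ρ.re → ρ.re < 1 → ρ.re = 1 / 2

/-- The crux's conclusion, which does NOT mention `ρ`: at some window the odd sector strictly
undercuts the even sector. -/
def OddSectorStrictlyWins : Prop :=
  ∃ a : ℝ, 0 < a ∧ ∃ o : ℝ → ℂ, IsWeilTest o ∧ tsupport o ⊆ Set.Icc (-a) a ∧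
    (∀ t, o (-t) = -o t) ∧ ∫ t, ‖o t‖ ^ 2 = (1 : ℝ) ∧ ∃ m : ℝ, 0 < m ∧
      ∀ e : ℝ → ℂ, IsWeilTest e → tsupport e ⊆ Set.Icc (-a) a → (∀ t, e (-t) = e t) →
        ∫ t, ‖e t‖ ^ 2 = (1 : ℝ) → (weilQuadratic o).re + m ≤ (weilQuadratic e).re

/-- `C ↔ (RHstrip ∨ conclusion)`: the antecedent only asks that SOME off-line zero exists. -/
theorem offLineParityDetection_iff_or :
    OffLineParityDetection ↔ (RHStrip ∨ OddSectorStrictlyWins) := by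
  constructor
  · intro hC
    by_cases hR : RHStrip
    · exact Or.inl hR
    · right
      simp only [RHStrip, not_forall] at hR
      obtain ⟨ρ, hζ, h0, h1, hne⟩ := hR
      exact hC ρ hζ h0 h1 hne
  · rintro (hR | hW) ρ hζ h0 h1 hne
    · exact absurd (hR ρ hζ h0 h1) hne
    · exact hW

/-- The conclusion of the crux is literally the negation of the route target. -/
theorem oddSectorStrictlyWins_iff_not_evenSectorWins :
    OddSectorStrictlyWins ↔ ¬ EvenSectorWins := by
  constructor
  · rintro ⟨a, ha, o, ho, hos, hodd, hon, m, hm, hdet⟩ hX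
    obtain ⟨e, he, hes, hev, hen, hle⟩ := hX a ha o ho hos hodd hon (m / 2) (by linarith)
    have := hdet e he hes hev hen
    linarith
  · intro hX
    unfold EvenSectorWins at hX
    push Not at hX
    obtain ⟨a, ha, o, ho, hos, hodd, hon, δ, hδ, hno⟩ := hX
    exact ⟨a, ha, o, ho, hos, hodd, hon, δ, hδ, fun e he hes hev hen ↦ (hno e he hes hev hen).le⟩

/-- **The crux is exactly the route's converse**: `C ↔ (EvenSectorWins → RHstrip)`. -/
theorem offLineParityDetection_iff_target_imp :
    OffLineParityDetection ↔ (EvenSectorWins → RHStrip) := by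
  rw [offLineParityDetection_iff_or, oddSectorStrictlyWins_iff_not_evenSectorWins]
  tauto

/-- `S → C` (strip form): under RH the crux is vacuous. -/
theorem offLineParityDetection_of_rhStrip (h : RHStrip) : OffLineParityDetection :=
  offLineParityDetection_iff_or.2 (Or.inl h)

/-- `S → C` with Mathlib's `RiemannHypothesis` binder (trivial zeros and `s = 1` are excluded by
`0 < Re ρ < 1`). -/
theorem offLineParityDetection_of_riemannHypothesis (h : RiemannHypothesis) :
    OffLineParityDetection := by
  refine offLineParityDetection_of_rhStrip fun ρ hζ h0 h1 ↦ h ρ hζ ?_ ?_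
  · rintro ⟨n, rfl⟩
    have : (-2 * ((n : ℂ) + 1)).re = -2 * (n + 1) := by simp
    rw [this] at h0
    have hn : (0 : ℝ) ≤ n := n.cast_nonneg
    linarith
  · rintro rfl
    simp at h1

/-- What a refutation of the crux would have to deliver: the route target AND an off-line zero. -/
theorem not_offLineParityDetection_iff :
    ¬ OffLineParityDetection ↔
      (EvenSectorWins ∧ ∃ ρ : ℂ, riemannZeta ρ = 0 ∧ 0 < ρ.re ∧ ρ.re < 1 ∧ ρ.re ≠ 1 / 2) := by
  rw [offLineParityDetection_iff_target_imp]
  constructor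
  · intro h
    by_contra h'
    exact h fun hX ρ hζ h0 h1 ↦ by_contra fun hne ↦ h' ⟨hX, ρ, hζ, h0, h1, hne⟩
  · rintro ⟨hX, ρ, hζ, h0, h1, hne⟩ h
    exact hne (h hX ρ hζ h0 h1)

/-- Any refutation of the crux disproves the Riemann Hypothesis. -/
theorem not_riemannHypothesis_of_not (h : ¬ OffLineParityDetection) : ¬ RiemannHypothesis :=
  fun hRH ↦ h (offLineParityDetection_of_riemannHypothesis hRH)

/-- Any refutation of the crux proves the route target `EvenSectorWins`. -/
theorem evenSectorWins_of_not (h : ¬ OffLineParityDetection) : EvenSectorWins :=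
  (not_offLineParityDetection_iff.1 h).1

/-- Calibration with the Assembly item: `C` makes `EvenSectorWins → RHstrip`, and conversely. So,
GIVEN the target, the crux is equivalent to RH-in-the-strip. -/
theorem offLineParityDetection_iff_rhStrip_of_target (hX : EvenSectorWins) :
    OffLineParityDetection ↔ RHStrip := by
  rw [offLineParityDetection_iff_target_imp]
  exact ⟨fun h ↦ h hX, fun h _ ↦ h⟩


/-! ### Energy form (sector bottoms `ε_od = weilOddGroundEnergy`, `ε_ev = weilEvenGroundEnergy`) -/

/-- The crux's conclusion in energy form: `∃ a > 0, ε_od(a) < ε_ev(a)`. -/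
theorem oddSectorStrictlyWins_iff_energy :
    OddSectorStrictlyWins ↔ ∃ a : ℝ, 0 < a ∧ weilOddGroundEnergy a < weilEvenGroundEnergy a := by
  constructor
  · rintro ⟨a, ha, o, ho, hos, hodd, hon, m, hm, hdet⟩
    refine ⟨a, ha, ?_⟩
    have h1 : weilOddGroundEnergy a ≤ (weilQuadratic o).re := weilOddGroundEnergy_le ho hos hodd hon
    have h2 : (weilQuadratic o).re + m ≤ weilEvenGroundEnergy a :=
      le_weilEvenGroundEnergy_of_forall ha fun e he hes hev hen ↦ hdet e he hes hev hen
    linarith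
  · rintro ⟨a, ha, hlt⟩
    rw [weilOddGroundEnergy_eq_sInf] at hlt
    obtain ⟨y, ⟨o, ho, hos, hodd, hon, rfl⟩, hy⟩ :=
      exists_lt_of_csInf_lt (weilWindowSphereValues_odd_nonempty ha) hlt
    refine ⟨a, ha, o, ho, hos, hodd, hon, weilEvenGroundEnergy a - (weilQuadratic o).re,
      sub_pos.2 hy, fun e he hes hev hen ↦ ?_⟩
    have := weilEvenGroundEnergy_le he hes hev hen
    linarith

/-- **The crux in energy form**: `C ↔ RHstrip ∨ ∃ a > 0, ε_od(a) < ε_ev(a)`. -/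
theorem offLineParityDetection_iff_energy :
    OffLineParityDetection ↔
      (RHStrip ∨ ∃ a : ℝ, 0 < a ∧ weilOddGroundEnergy a < weilEvenGroundEnergy a) := by
  rw [offLineParityDetection_iff_or, oddSectorStrictlyWins_iff_energy]

/-- **The target in energy form**: `EvenSectorWins ↔ ∀ a > 0, ε_ev(a) ≤ ε_od(a)`. -/
theorem evenSectorWins_iff_energy :
    EvenSectorWins ↔ ∀ a : ℝ, 0 < a → weilEvenGroundEnergy a ≤ weilOddGroundEnergy a := by
  constructor
  · intro hX a ha
    by_contra hlt
    exact oddSectorStrictlyWins_iff_not_evenSectorWins.1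
      (oddSectorStrictlyWins_iff_energy.2 ⟨a, ha, not_le.1 hlt⟩) hX
  · intro h
    by_contra hX
    obtain ⟨a, ha, hlt⟩ :=
      oddSectorStrictlyWins_iff_energy.1 (oddSectorStrictlyWins_iff_not_evenSectorWins.2 hX)
    exact absurd hlt (not_lt.2 (h a ha))

end Summit.RiemannHypothesis.RiemannHypothesis.Cruxes.OffLineParityDetection.CruxAttack
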